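import Mathlib
import Literature.NumberTheory.Transcendental.OkadaHurwitzBernoulliProofs
import HarnessLib

/-!
# Okada's theorem (Hurwitz-zeta form), II: Galois transport, character orthogonality, the theorem

Topic `Literature/NumberTheory/Transcendental`. Proofs-only file (theorems only, no new definition, no new fact):
`okada_linearIndependent_hurwitzZeta_holds` DISCHARGES the named fact
`Literature.NumberTheory.Transcendental.okada_linearIndependent_hurwitzZeta` of `OkadaLinearIndependence.lean` —
OKADA'S THEOREM [Okada1981, Theorem] in the Hurwitz-zeta form of Gun–Murty–Rath [GunRammurtyRath2011, Lemma 1 and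
eq. (2), proof of Thm. 1 (p. 1332)]: for all integers `k ≥ 2`, `q ≥ 3` the `φ(q)/2` real numbers
`ζ(k, a/q) + (−1)^k ζ(k, 1 − a/q)`, `1 ≤ a < q/2`, `(a, q) = 1`, are linearly independent over `ℚ` (the
"free half" `dim_ℚ V_k^+(q) = φ(q)/2` of the Chowla–Milnor conjecture).

Sources: [cite: Okada1981, Theorem]; [cite: GunRammurtyRath2011, Lemma 1 + eq. (2), p. 1332]. The route is the printed
one ("the proof in [GMR] uses the expansion of Bernoulli polynomials" — Chatterjee–Murty, *On the dimension of
Chowla–Milnor space*, arXiv:1308.6445, p. 3, held as `paper:arxiv-1308.6445`), all of whose ingredients are Mathlib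
theorems. Architecture (five steps; with `w(r) = ζ(k, r/q) + (−1)^k ζ(k, −r/q)`, `ζ(k, x) = hurwitzZeta x k` on `ℝ/ℤ`,
`𝕖(m) = e^{2πim/q}`, `ζ_q = e^{2πi/q}`):

* (A) [file I, `Okada.hurwitz_symm_eq_bernoulli_sum`] `w(r) = q^{k−1}(−(2πi)^k/k!) Σ_j 𝕖(−jr) B_k(j/q)` (Fourier
  expansion of the Bernoulli polynomial + root-of-unity filter), so a rational relation `Σ_a c_a w(a) = 0` says that
  `ζ_q` is a root of the explicit rational polynomial `P = Σ_a c_a Σ_j B_k(j/q) X^{(−ja) mod q} ∈ ℚ[X]`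
  (`Okada.aeval_exp_pow_bernoulliPoly`);
* (B) GALOIS TRANSPORT [this file, `Okada.relation_transport`]: `minpoly_ℚ(ζ_q) = Φ_q = minpoly_ℚ(ζ_q^t)` for
  `(t, q) = 1` (Mathlib `cyclotomic_eq_minpoly_rat`, `IsPrimitiveRoot.pow_of_coprime`), so `P(ζ_q^t) = 0` too, i.e.
  `Σ_a c_a w(at) = 0` for every unit `t` mod `q`;
* (C) CHARACTER SUMS [file I, `Okada.sum_char_mul_hurwitz_symm`]: `Σ_r χ(r) w(r) = (1 + (−1)^kχ(−1)) q^k L(k, χ)`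
  (Mathlib's definition of `ZMod.LFunction`) with `L(k, χ) ≠ 0` (`k ≥ 2`);
* (D) [this file] multiplying the relation at `t` by `χ(t)` and summing over `t` gives
  `(Σ_a c_a χ(a)⁻¹)·(1 + (−1)^kχ(−1)) q^k L(k,χ) = 0`, whence `(1 + (−1)^kχ(−1)) Σ_a c_a χ(a)⁻¹ = 0` for EVERY
  Dirichlet character `χ` mod `q` (`Okada.sum_coeff_char_inv_eq_zero`); summing
  `(1 + (−1)^kχ(−1)) (Σ_a c_a χ(a)⁻¹) χ(b)` over all `χ` (orthogonality, Mathlib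
  `DirichletCharacter.sum_char_inv_mul_char_eq`) gives `φ(q)(c_b + (−1)^k c_{−b}) = 0`; on the half-system
  `1 ≤ a < q/2` no two indices are negatives of each other mod `q` (`0 < a + a' < q`), so every `c_a = 0`
  (`Okada.coeff_eq_zero`);
* (E) [this file] `linearIndependent_iff'` after casting the real relation to `ℂ` (`Okada.ofReal_hurwitz_symm`).

The two rescalings `okada_linearIndependent_hurwitzZeta.level_scaled` / `.int_tsum` of the statement file become
unconditional here (`okada_linearIndependent_level_scaled`, `okada_linearIndependent_int_tsum`).

HONEST FRAMING (cells pub-zeta5 / zeta5-irr: systematic search; no irrationality claim unless kernel-certified): a 1981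
linear-independence theorem about Hurwitz zeta values at rational points, made a kernel theorem; nothing here concerns
`ζ(5)`; the Chowla–Milnor conjecture itself (the other half) remains OPEN and is not touched.
-/

noncomputable section

open Complex Real Set Finset HurwitzZeta Polynomial

open scoped Nat

namespace Literature.NumberTheory.Transcendental.Okada

variable {q : ℕ} [NeZero q]

/-! ### The cyclotomic bookkeeping: `ζ_q^n = 𝕖(n)` -/

/-- `ζ_q^n = 𝕖(n mod q)`. [folklore] -/
private theorem exp_pow_eq_stdAddChar (n : ℕ) :
    Complex.exp (2 * π * I / q) ^ n = ZMod.stdAddChar (n : ZMod q) := by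
  have h : ZMod.stdAddChar (n : ZMod q) = Complex.exp (2 * π * I * n / q) := by
    simpa using ZMod.stdAddChar_coe (N := q) (n : ℤ)
  rw [h, ← Complex.exp_nat_mul]
  congr 1
  ring

omit [NeZero q] in
/-- The Bernoulli polynomial at the rational point `j/q`: Mathlib's real `bernoulliFun k (j/q)` is the rational number
`B_k(j/q)`. [folklore] -/
private theorem bernoulliFun_val_div (k : ℕ) (j : ZMod q) :
    (bernoulliFun k ((j.val : ℝ) / q) : ℂ) =
      (((Polynomial.bernoulli k).eval ((j.val : ℚ) / q) : ℚ) : ℂ) := by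
  have h1 : ((j.val : ℝ) / q : ℝ) = (((j.val : ℚ) / q : ℚ) : ℝ) := by push_cast; ring
  rw [bernoulliFun, h1, Polynomial.eval_map, ← eq_ratCast (algebraMap ℚ ℝ), Polynomial.eval₂_at_apply,
    eq_ratCast, Complex.ofReal_ratCast]

/-- The rational polynomial `P_r = Σ_{j mod q} B_k(j/q) X^{(−jr) mod q}` evaluated at `ζ_q^t`:
`P_r(ζ_q^t) = Σ_j 𝕖(−j·rt) B_k(j/q)` — the Galois conjugates of `P_r(ζ_q)` are the same sums at the twisted residues
`rt`. [cite: GunRammurtyRath2011, proof of Thm. 1 (p. 1332)] -/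
theorem aeval_exp_pow_bernoulliPoly (k t : ℕ) (r : ZMod q) :
    aeval (Complex.exp (2 * π * I / q) ^ t)
        (∑ j : ZMod q, C ((Polynomial.bernoulli k).eval ((j.val : ℚ) / q)) * X ^ (-(j * r)).val) =
      ∑ j : ZMod q, ZMod.stdAddChar (-(j * (r * (t : ZMod q)))) *
        (bernoulliFun k ((j.val : ℝ) / q) : ℂ) := by
  rw [map_sum]
  refine Finset.sum_congr rfl fun j _ => ?_
  rw [map_mul, aeval_C, map_pow, aeval_X, ← pow_mul, exp_pow_eq_stdAddChar, eq_ratCast, mul_comm,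
    bernoulliFun_val_div]
  congr 2
  push_cast
  rw [ZMod.natCast_zmod_val]
  ring

/-- If a rational polynomial vanishes at `ζ_q = e^{2πi/q}` then it vanishes at every primitive `q`-th root `ζ_q^t`,
`(t, q) = 1`: both have minimal polynomial `Φ_q` over `ℚ` (irreducibility of the cyclotomic polynomial; Mathlib
`cyclotomic_eq_minpoly_rat`). [folklore] -/
private theorem aeval_pow_eq_zero_of_aeval_eq_zero {P : ℚ[X]} (hP : aeval (Complex.exp (2 * π * I / q)) P = 0)
    {t : ℕ} (ht : t.Coprime q) : aeval (Complex.exp (2 * π * I / q) ^ t) P = 0 := by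
  have hζ := Complex.isPrimitiveRoot_exp q (NeZero.ne q)
  have hζt := hζ.pow_of_coprime t ht
  have hpos : 0 < q := Nat.pos_of_ne_zero (NeZero.ne q)
  have hdvd : minpoly ℚ (Complex.exp (2 * π * I / q) ^ t) ∣ P := by
    rw [← Polynomial.cyclotomic_eq_minpoly_rat hζt hpos, Polynomial.cyclotomic_eq_minpoly_rat hζ hpos]
    exact minpoly.dvd ℚ _ hP
  obtain ⟨Q, hQ⟩ := hdvd
  rw [hQ, map_mul, minpoly.aeval, zero_mul]

/-! ### Step 2: Galois transport of a rational relation -/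

/-- **Galois transport.** If rational numbers `c_i` and residues `r_i` satisfy
`Σ_i c_i (ζ(k, r_i/q) + (−1)^k ζ(k, −r_i/q)) = 0` (`k ≥ 2`), then for every `t` coprime to `q` also
`Σ_i c_i (ζ(k, r_i t/q) + (−1)^k ζ(k, −r_i t/q)) = 0`: by file I the relation is `P(ζ_q) = 0` for a polynomial
`P ∈ ℚ[X]`, and `P(ζ_q^t) = 0` is the twisted relation. [cite: Okada1981, Theorem (proof)] -/
theorem relation_transport {k : ℕ} (hk : 2 ≤ k) {ι : Type*} (S : Finset ι) (c : ι → ℚ) (v : ι → ZMod q)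
    (h : ∑ i ∈ S, (c i : ℂ) * (hurwitzZeta (ZMod.toAddCircle (v i)) k +
        (-1 : ℂ) ^ k * hurwitzZeta (ZMod.toAddCircle (-(v i))) k) = 0)
    {t : ℕ} (ht : t.Coprime q) :
    ∑ i ∈ S, (c i : ℂ) * (hurwitzZeta (ZMod.toAddCircle (v i * (t : ZMod q))) k +
        (-1 : ℂ) ^ k * hurwitzZeta (ZMod.toAddCircle (-(v i * (t : ZMod q)))) k) = 0 := by
  -- the constant `K = q^{k-1} (−(2πi)^k/k!) ≠ 0`
  have hK : (q : ℂ) ^ (k - 1) * (-(2 * π * I) ^ k / k !) ≠ 0 := by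
    have h1 : (q : ℂ) ≠ 0 := by exact_mod_cast NeZero.ne q
    have h2 : (2 * π * I : ℂ) ^ k ≠ 0 := pow_ne_zero _ two_pi_I_ne_zero
    have h3 : (k ! : ℂ) ≠ 0 := by exact_mod_cast Nat.factorial_ne_zero k
    exact mul_ne_zero (pow_ne_zero _ h1) (div_ne_zero (neg_ne_zero.mpr h2) h3)
  -- the polynomial `P = Σ_i c_i P_{r_i}`
  set P : ℚ[X] := ∑ i ∈ S, C (c i) *
    ∑ j : ZMod q, C ((Polynomial.bernoulli k).eval ((j.val : ℚ) / q)) * X ^ (-(j * v i)).val with hPdef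
  have hPeval : ∀ t : ℕ, aeval (Complex.exp (2 * π * I / q) ^ t) P * ((q : ℂ) ^ (k - 1) * (-(2 * π * I) ^ k / k !)) =
      ∑ i ∈ S, (c i : ℂ) * (hurwitzZeta (ZMod.toAddCircle (v i * (t : ZMod q))) k +
        (-1 : ℂ) ^ k * hurwitzZeta (ZMod.toAddCircle (-(v i * (t : ZMod q)))) k) := by
    intro t
    rw [hPdef, map_sum, Finset.sum_mul]
    refine Finset.sum_congr rfl fun i _ => ?_
    rw [map_mul, aeval_C, eq_ratCast, aeval_exp_pow_bernoulliPoly, hurwitz_symm_eq_bernoulli_sum hk]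
    ring
  have hP0 : aeval (Complex.exp (2 * π * I / q)) P = 0 := by
    have := hPeval 1
    rw [pow_one] at this
    simp only [Nat.cast_one, mul_one] at this
    rw [h] at this
    exact (mul_eq_zero.mp this).resolve_right hK
  rw [← hPeval t, aeval_pow_eq_zero_of_aeval_eq_zero hP0 ht, zero_mul]

/-! ### Step 3: the coefficients are orthogonal to the characters of parity `(−1)^k` -/

/-- Twisting the character sum: for a unit `u` mod `q`, `Σ_r χ(r) f(ur) = χ(u⁻¹) Σ_r χ(r) f(r)`. [folklore] -/
private theorem sum_char_mul_comp_unit (χ : DirichletCharacter ℂ q) (u : (ZMod q)ˣ) (f : ZMod q → ℂ) :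
    ∑ r : ZMod q, χ r * f (u * r) = χ ((u : ZMod q)⁻¹) * ∑ r : ZMod q, χ r * f r := by
  rw [Finset.mul_sum]
  have : ∀ r : ZMod q, χ r * f (u * r) = (fun y => χ ((u : ZMod q)⁻¹) * (χ y * f y)) (u.mulLeft r) := by
    intro r
    simp only [Units.mulLeft_apply]
    rw [← mul_assoc, ← map_mul, ← mul_assoc, ZMod.inv_coe_unit, Units.inv_mul, one_mul]
  simp_rw [this]
  exact Equiv.sum_comp (u.mulLeft) (fun y => χ ((u : ZMod q)⁻¹) * (χ y * f y))

/-- **Orthogonality to the characters of the right parity.** If the rational coefficients `c_i` at units `v_i` mod `q`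
satisfy the twisted relations `Σ_i c_i (ζ(k, v_i t/q) + (−1)^k ζ(k, −v_i t/q)) = 0` for every `t` coprime to `q`
(`k ≥ 2`), then `(1 + (−1)^k χ(−1)) · Σ_i c_i χ(v_i⁻¹) = 0` for every Dirichlet character `χ` mod `q`: multiply the
relation at `t` by `χ(t)`, sum over `t`, and use `Σ_r χ(r)(ζ(k,r/q) + (−1)^kζ(k,−r/q)) = (1 + (−1)^kχ(−1)) q^k L(k,χ)`
with `L(k, χ) ≠ 0`. [cite: Okada1981, Theorem (proof)] -/
theorem sum_coeff_char_inv_eq_zero {k : ℕ} (hk : 2 ≤ k) {ι : Type*} (S : Finset ι) (c : ι → ℚ) (v : ι → ZMod q)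
    (hunit : ∀ i ∈ S, IsUnit (v i))
    (h : ∀ t : ℕ, t.Coprime q → ∑ i ∈ S, (c i : ℂ) * (hurwitzZeta (ZMod.toAddCircle (v i * (t : ZMod q))) k +
        (-1 : ℂ) ^ k * hurwitzZeta (ZMod.toAddCircle (-(v i * (t : ZMod q)))) k) = 0)
    (χ : DirichletCharacter ℂ q) :
    (1 + (-1 : ℂ) ^ k * χ (-1)) * ∑ i ∈ S, (c i : ℂ) * χ (v i)⁻¹ = 0 := by
  set w : ZMod q → ℂ := fun r => hurwitzZeta (ZMod.toAddCircle r) k +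
    (-1 : ℂ) ^ k * hurwitzZeta (ZMod.toAddCircle (-r)) k with hw
  -- the relation holds at every residue `r`, after multiplication by `χ r`
  have hr : ∀ r : ZMod q, χ r * ∑ i ∈ S, (c i : ℂ) * w (v i * r) = 0 := by
    intro r
    by_cases hru : IsUnit r
    · obtain ⟨u, rfl⟩ := hru
      have hcop := ZMod.val_coe_unit_coprime u
      have := h (u : ZMod q).val hcop
      rw [ZMod.natCast_zmod_val] at this
      rw [this, mul_zero]
    · rw [MulChar.map_nonunit χ hru, zero_mul]
  have hsum : ∑ r : ZMod q, χ r * ∑ i ∈ S, (c i : ℂ) * w (v i * r) = 0 :=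
    Finset.sum_eq_zero fun r _ => hr r
  -- swap the sums and twist each character sum back to `Σ_r χ(r) w(r)`
  have hswap : ∑ r : ZMod q, χ r * ∑ i ∈ S, (c i : ℂ) * w (v i * r) =
      (∑ i ∈ S, (c i : ℂ) * χ (v i)⁻¹) * ∑ r : ZMod q, χ r * w r := by
    calc ∑ r : ZMod q, χ r * ∑ i ∈ S, (c i : ℂ) * w (v i * r)
        = ∑ r : ZMod q, ∑ i ∈ S, χ r * ((c i : ℂ) * w (v i * r)) :=
          Finset.sum_congr rfl fun r _ => Finset.mul_sum _ _ _
      _ = ∑ i ∈ S, ∑ r : ZMod q, χ r * ((c i : ℂ) * w (v i * r)) := Finset.sum_comm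
      _ = ∑ i ∈ S, (c i : ℂ) * χ (v i)⁻¹ * ∑ r : ZMod q, χ r * w r := by
          refine Finset.sum_congr rfl fun i hi => ?_
          obtain ⟨u, hu⟩ := hunit i hi
          have h1 : ∑ r : ZMod q, χ r * ((c i : ℂ) * w (v i * r)) =
              (c i : ℂ) * ∑ r : ZMod q, χ r * w (u * r) := by
            rw [Finset.mul_sum]
            refine Finset.sum_congr rfl fun r _ => ?_
            rw [hu]; ring
          rw [h1, sum_char_mul_comp_unit χ u w, hu, mul_assoc]
      _ = (∑ i ∈ S, (c i : ℂ) * χ (v i)⁻¹) * ∑ r : ZMod q, χ r * w r := by rw [Finset.sum_mul]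
  rw [hswap, hw] at hsum
  simp only at hsum
  rw [sum_char_mul_hurwitz_symm χ k] at hsum
  -- `q^k L(k, χ) ≠ 0`
  have hne : (q : ℂ) ^ k * χ.LFunction k ≠ 0 :=
    mul_ne_zero (pow_ne_zero _ (by exact_mod_cast NeZero.ne q)) (LFunction_nat_ne_zero χ hk)
  rcases mul_eq_zero.mp hsum with hA | hBC
  · rw [hA, mul_zero]
  · rcases mul_eq_zero.mp hBC with hB | hC
    · rw [hB, zero_mul]
    · exact absurd hC hne

/-! ### Step 4: orthogonality of characters — every coefficient vanishes -/

/-- **Vanishing of the coefficients.** Under the hypotheses of `sum_coeff_char_inv_eq_zero`, if moreover the residues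
`v_i` (`i ∈ S`) are pairwise distinct and no two of them are negatives of each other mod `q`, then every `c_i = 0`:
sum `(1 + (−1)^kχ(−1))(Σ_i c_i χ(v_i⁻¹))χ(v_{i₀}) = 0` over all characters `χ` and use
`Σ_χ χ(a⁻¹)χ(b) = φ(q)[a = b]` (Mathlib `DirichletCharacter.sum_char_inv_mul_char_eq`), which leaves
`φ(q) · c_{i₀} = 0`. [cite: Okada1981, Theorem (proof)] -/
theorem coeff_eq_zero {k : ℕ} (hk : 2 ≤ k) {ι : Type*} (S : Finset ι) (c : ι → ℚ) (v : ι → ZMod q)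
    (hunit : ∀ i ∈ S, IsUnit (v i))
    (hinj : ∀ i ∈ S, ∀ i' ∈ S, v i = v i' → i = i')
    (hneg : ∀ i ∈ S, ∀ i' ∈ S, v i ≠ -v i')
    (h : ∀ t : ℕ, t.Coprime q → ∑ i ∈ S, (c i : ℂ) * (hurwitzZeta (ZMod.toAddCircle (v i * (t : ZMod q))) k +
        (-1 : ℂ) ^ k * hurwitzZeta (ZMod.toAddCircle (-(v i * (t : ZMod q)))) k) = 0) :
    ∀ i ∈ S, c i = 0 := by
  classical
  intro i₀ hi₀
  have hχ := sum_coeff_char_inv_eq_zero hk S c v hunit h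
  -- sum the vanishing quantities against `χ(v i₀)`
  have htot : ∑ χ : DirichletCharacter ℂ q,
      ((1 + (-1 : ℂ) ^ k * χ (-1)) * ∑ i ∈ S, (c i : ℂ) * χ (v i)⁻¹) * χ (v i₀) = 0 :=
    Finset.sum_eq_zero fun χ _ => by rw [hχ χ, zero_mul]
  -- and evaluate the same sum by orthogonality
  have hcalc : ∑ χ : DirichletCharacter ℂ q,
      ((1 + (-1 : ℂ) ^ k * χ (-1)) * ∑ i ∈ S, (c i : ℂ) * χ (v i)⁻¹) * χ (v i₀) =
      ∑ i ∈ S, (c i : ℂ) * ((∑ χ : DirichletCharacter ℂ q, χ (v i)⁻¹ * χ (v i₀)) +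
        (-1 : ℂ) ^ k * ∑ χ : DirichletCharacter ℂ q, χ (v i)⁻¹ * χ (-(v i₀))) := by
    have hexp : ∀ χ : DirichletCharacter ℂ q,
        ((1 + (-1 : ℂ) ^ k * χ (-1)) * ∑ i ∈ S, (c i : ℂ) * χ (v i)⁻¹) * χ (v i₀) =
        ∑ i ∈ S, (c i : ℂ) * (χ (v i)⁻¹ * χ (v i₀) + (-1 : ℂ) ^ k * (χ (v i)⁻¹ * χ (-(v i₀)))) := by
      intro χ
      rw [Finset.mul_sum, Finset.sum_mul]
      refine Finset.sum_congr rfl fun i _ => ?_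
      rw [show (-(v i₀) : ZMod q) = (-1) * v i₀ by ring, map_mul]
      ring
    simp_rw [hexp]
    rw [Finset.sum_comm]
    refine Finset.sum_congr rfl fun i _ => ?_
    rw [← Finset.mul_sum, Finset.sum_add_distrib, ← Finset.mul_sum]
  have horth : ∀ i ∈ S, ((∑ χ : DirichletCharacter ℂ q, χ (v i)⁻¹ * χ (v i₀)) +
        (-1 : ℂ) ^ k * ∑ χ : DirichletCharacter ℂ q, χ (v i)⁻¹ * χ (-(v i₀))) =
      if i = i₀ then (q.totient : ℂ) else 0 := by
    intro i hi
    rw [DirichletCharacter.sum_char_inv_mul_char_eq ℂ (hunit i hi) (v i₀),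
      DirichletCharacter.sum_char_inv_mul_char_eq ℂ (hunit i hi) (-(v i₀)), if_neg (hneg i hi i₀ hi₀),
      mul_zero, add_zero]
    by_cases hii : i = i₀
    · rw [if_pos hii, if_pos (by rw [hii])]
    · rw [if_neg hii, if_neg (fun h' => hii (hinj i hi i₀ hi₀ h'))]
  rw [hcalc, Finset.sum_congr rfl fun i hi => by rw [horth i hi]] at htot
  simp only [mul_ite, mul_zero, Finset.sum_ite_eq', if_pos hi₀] at htot
  have hφ : (q.totient : ℂ) ≠ 0 := by
    exact_mod_cast (Nat.totient_pos.mpr (Nat.pos_of_ne_zero (NeZero.ne q))).ne'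
  exact_mod_cast (mul_eq_zero.mp htot).resolve_right hφ

end Okada

/-! ### The theorem -/

open Okada in
/-- **Okada's theorem (Hurwitz-zeta form; the free half of the Chowla–Milnor conjecture) — PROVED.**
For all integers `k ≥ 2` and `q ≥ 3` the `φ(q)/2` real numbers `ζ(k, a/q) + (−1)^k ζ(k, 1 − a/q)`,
`1 ≤ a < q/2`, `(a, q) = 1` (`ζ(k, x) = Σ_{n ≥ 0} (n + x)^{−k}`), are linearly independent over `ℚ`
[Okada1981, Theorem] = [GunRammurtyRath2011, Lemma 1 with eq. (2), proof of Thm. 1 (p. 1332)].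
Proof (the printed route, via the Fourier expansion of the Bernoulli polynomials): a rational relation is a rational
polynomial relation for `ζ_q = e^{2πi/q}` (file I), hence survives `ζ_q ↦ ζ_q^t` (`Okada.relation_transport`); the
twisted relations make the coefficient vector orthogonal to every Dirichlet character of parity `(−1)^k`, because
`Σ_r χ(r)(ζ(k, r/q) + (−1)^k ζ(k, −r/q)) = (1 + (−1)^kχ(−1)) q^k L(k, χ) ≠ 0` for those `χ`
(`Okada.sum_coeff_char_inv_eq_zero`); character orthogonality on the half-system finishes (`Okada.coeff_eq_zero`).
This discharges the named fact (net Literature debt −1); its corollaries `….level_scaled` and `….int_tsum` become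
unconditional. [cite: Okada1981, Theorem] [cite: GunRammurtyRath2011, Lemma 1 and eq. (2), proof of Thm. 1 (p. 1332)] -/
theorem okada_linearIndependent_hurwitzZeta_holds : okada_linearIndependent_hurwitzZeta := by
  intro k q hk hq
  haveI : NeZero q := ⟨by omega⟩
  rw [linearIndependent_iff']
  intro S g hsum i₀ hi₀
  -- the relation, cast to `ℂ`, in terms of Mathlib's Hurwitz zeta function
  have hrel : ∑ i ∈ S, (g i : ℂ) * (hurwitzZeta (ZMod.toAddCircle ((i.1 : ℕ) : ZMod q)) k +
      (-1 : ℂ) ^ k * hurwitzZeta (ZMod.toAddCircle (-((i.1 : ℕ) : ZMod q))) k) = 0 := by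
    have h := congrArg (fun x : ℝ => (x : ℂ)) hsum
    simp only [Rat.smul_def, Complex.ofReal_sum, Complex.ofReal_mul, Complex.ofReal_ratCast,
      Complex.ofReal_zero] at h
    rw [← h]
    refine Finset.sum_congr rfl fun i _ => ?_
    rw [ofReal_hurwitz_symm hk (by have := i.2.1; omega)]
  -- Galois transport
  have htw : ∀ t : ℕ, t.Coprime q → ∑ i ∈ S, (g i : ℂ) *
      (hurwitzZeta (ZMod.toAddCircle (((i.1 : ℕ) : ZMod q) * (t : ZMod q))) k +
        (-1 : ℂ) ^ k * hurwitzZeta (ZMod.toAddCircle (-(((i.1 : ℕ) : ZMod q) * (t : ZMod q)))) k) = 0 :=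
    fun t ht => relation_transport hk S g (fun i => ((i.1 : ℕ) : ZMod q)) hrel ht
  -- the half-system: units, pairwise distinct, never opposite
  have hunit : ∀ i ∈ S, IsUnit (((i.1 : ℕ) : ZMod q)) := fun i _ =>
    (ZMod.isUnit_iff_coprime i.1 q).mpr i.2.2
  have hinj : ∀ i ∈ S, ∀ i' ∈ S, ((i.1 : ℕ) : ZMod q) = ((i'.1 : ℕ) : ZMod q) → i = i' := by
    intro i _ i' _ h
    have h1 : (i.1 : ℕ) < q := by have := i.2.1; omega
    have h2 : (i'.1 : ℕ) < q := by have := i'.2.1; omega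
    rw [ZMod.natCast_eq_natCast_iff] at h
    exact Subtype.ext (Nat.ModEq.eq_of_lt_of_lt h h1 h2)
  have hneg : ∀ i ∈ S, ∀ i' ∈ S, ((i.1 : ℕ) : ZMod q) ≠ -((i'.1 : ℕ) : ZMod q) := by
    intro i _ i' _ h
    have h1 : 2 * (i.1 : ℕ) < q := i.2.1
    have h2 : 2 * (i'.1 : ℕ) < q := i'.2.1
    have hi1 : (i.1 : ℕ) ≠ 0 := by
      intro h0
      have := i.2.2
      rw [h0, Nat.coprime_zero_left] at this
      omega
    have hsum0 : (((i.1 : ℕ) + (i'.1 : ℕ) : ℕ) : ZMod q) = 0 := by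
      push_cast
      rw [h]; ring
    rw [ZMod.natCast_eq_zero_iff] at hsum0
    have := Nat.le_of_dvd (by omega) hsum0
    omega
  exact coeff_eq_zero hk S g (fun i => ((i.1 : ℕ) : ZMod q)) hunit hinj hneg htw i₀ hi₀

/-- **Level-scaled form, unconditional**: for `k ≥ 2`, `q ≥ 3` the real numbers
`Σ_{n ≥ 0} (qn + a)^{−k} + (−1)^k Σ_{n ≥ 0} (qn + (q − a))^{−k}`, `1 ≤ a < q/2`, `(a, q) = 1`, are linearly independent
over `ℚ` (the statement file's `okada_linearIndependent_hurwitzZeta.level_scaled` fed with the theorem).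
[cite: GunRammurtyRath2011, Lemma 1 and eq. (2), p. 1332] -/
theorem okada_linearIndependent_level_scaled {k q : ℕ} (hk : 2 ≤ k) (hq : 3 ≤ q) :
    LinearIndependent ℚ fun a : {a : ℕ // 2 * a < q ∧ Nat.Coprime a q} =>
      (∑' n : ℕ, 1 / ((q : ℝ) * n + (a : ℕ)) ^ k) +
        (-1 : ℝ) ^ k * ∑' n : ℕ, 1 / ((q : ℝ) * n + ((q : ℝ) - (a : ℕ))) ^ k :=
  okada_linearIndependent_hurwitzZeta.level_scaled okada_linearIndependent_hurwitzZeta_holds hk hq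

/-- **Two-sided form, unconditional**: for `k ≥ 2`, `q ≥ 3` the real numbers `Σ_{n ∈ ℤ} (n + a/q)^{−k}`,
`1 ≤ a < q/2`, `(a, q) = 1`, are linearly independent over `ℚ` (the statement file's
`okada_linearIndependent_hurwitzZeta.int_tsum` fed with the theorem). [cite: GunRammurtyRath2011, Lemma 1 and eq. (2), p. 1332] -/
theorem okada_linearIndependent_int_tsum {k q : ℕ} (hk : 2 ≤ k) (hq : 3 ≤ q) :
    LinearIndependent ℚ fun a : {a : ℕ // 2 * a < q ∧ Nat.Coprime a q} =>
      ∑' n : ℤ, 1 / ((n : ℝ) + (a : ℕ) / (q : ℝ)) ^ k :=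
  okada_linearIndependent_hurwitzZeta.int_tsum okada_linearIndependent_hurwitzZeta_holds hk hq

end Literature.NumberTheory.Transcendental
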